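/-
Copyright (c) 2026. All rights reserved.
Released under Apache 2.0 license as described in the file LICENSE.
Authors: abc-iut cell, prover seat abc-iut-f-101 (F fact-proving wave), over the statements of abc-iut-L4-t3.
-/
import Literature.AnabelianGeometry.AbsoluteAnabelian.DiagramCores
import Literature.AnabelianGeometry.AbsoluteAnabelian.LogFrobeniusObservablesMoves
import Literature.AnabelianGeometry.AbsoluteAnabelian.LogFrobeniusObservablesIotaSquare
import HarnessLib

/-!
# [AbsTopIII] Corollary 5.5 (iii), `⊞`-half: the observable `S_log⊞` CONSTRUCTED from commuting `ι⊞`-squares — `Cor55Observables` (FACT-LIST F-0142) is EQUIVALENT to the Def 5.4 (iii) commutativity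

S. Mochizuki, *Topics in absolute anabelian geometry III: global reconstruction algorithms*,
J. Math. Sci. Univ. Tokyo 22 (2015) 939–1156 [MochizukiAbsTopIII2015]; locators `p.N` = pages of the author's
manuscript (`paper:url-5493eb38cbb7`): Def 5.4 (iii) p. 126 (the commutative diagram defining `Γ⃗^log_non`), (v)
p. 127, (vii) p. 128 (`ι⊞_{v,ε}`), Cor 5.5 (iii) p. 131 ("the natural transformations `ι⊞_{v,ε}` belong to a family of
homotopies on `D•_{≤3}` that determines on the portion of `D•_{≤3}` indexed by `v` a structure of observable `S_log⊞`
on `D•_{≤2}`"), proof p. 132 ("immediate from the definitions"), §0 p. 26 / Def 3.5 (ii)–(iii) pp. 75–76.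

PROOF companion of abc-iut-L4-t3's `LogFrobeniusCorollaries.lean` (`LogFrobeniusSetting.IsLogObservablePlus`,
`Cor55Observables` = frozen FACT-LIST row F-0142) completing `LogFrobeniusObservablesIotaSquare.lean` (necessity:
`iota_comp_eq_of_cor55Observables`; universal closure refuted) by the CONVERSE.  The typed Cor 5.5 (iii) is thereby
located EXACTLY over the interface:

  `cor55Observables_iff_iotaSquaresCommute : L.Cor55Observables ↔ ∀ v, L.IotaSquaresCommute v`,

where `IotaSquaresCommute L v` is the commutativity of the `ι⊞`-squares of `Γ⃗^log_v` (any two 2-chains of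
`ι⊞`-carrying edges between pre-log vertices with common end-vertices have equal composite `ι⊞`-components) — the
Def 5.4 (iii) commutativity transported to the `ι⊞`'s, which print has and the interface does not record.  At an
archimedean place it is automatic (`iotaSquaresCommute_of_isArc`: `Γ⃗^log_arc` is linear), so over an index set with
only archimedean places `Cor55Observables L` holds for EVERY `L` (`cor55Observables_of_forall_isArc`); in general it
bites exactly through the nonarchimedean squares `𝒪^×_k̄ ↪ k̄^× → (k̄^×)^pf` / `𝒪^×_k̄ → k~ ↪ (k̄^×)^pf`.

CONSTRUCTION (the printed proof "immediate from the definitions", made explicit): the boundary set of `S_log⊞` is the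
saturation of the two printed kinds of pairs (`LogGen`, `LogFrobeniusObservablesMoves.lean`), i.e. "pairs of paths into
`𝒩⊞_v` joined by a chain of whiskered generator moves", and its homotopies are the composites of whiskered `ι⊞`'s
(toolkit `DiagramChainFamilies.chainFamily`).  This is well defined iff COHERENT — any two chains between the same two
paths have the same composite — and `chain_hom_eq_of_iotaSquaresCommute` proves coherence from the square condition
by induction on the weight of the source path (`pathWt`, strictly lowered by every move): two chains out of one path
start with the same move (unique decomposition, `eq_of_comp_lamPath_eq` & co.; no edge leaves the space-link vertex;
one edge leaves the post-log vertex) unless they take the two branches of the nonarchimedean fork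
`𝒪^×_k̄ → {k̄^×, k~}` (`LogVertex.logEdge_fork`), which closes at once into `(k̄^×)^pf` with equal composites
(`moveHom_square`, from the hypothesis).  `logObsFamily` is the resulting family; `isLogObservablePlus_logObsFamily`
checks the typed observable conditions (the generator pairs carry `ι⊞_{v,ε}` componentwise, `chainFamily_η_gen`).

HONEST LABEL: this discharges the typed row F-0142 EXACTLY MODULO the named interface-level datum (no side is taken on
whether any particular `L` satisfies it; print's genuine theaters do by Def 5.4 (iii)); `IotaSquaresCommute` is a
definition (the hypothesis of the iff), not a new fact.  Refereed pre-IUT material; nothing here bears on [IUTchIII]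
Cor. 3.12; OUR kernel check, no side taken.
-/

set_option autoImplicit false

universe u

open CategoryTheory Quiver

namespace Literature.AnabelianGeometry.AbsoluteAnabelian

namespace LogFrobeniusSetting

variable {Vmod : Type u} {isArc : Vmod → Bool} (L : LogFrobeniusSetting Vmod isArc) (v : Vmod)

/-- `moveHom` is multiplicative in the generator homotopy (composition of two moves with the same prefix).
[cite: MochizukiAbsTopIII2015, Definition 3.5 (ii) p.75] -/
theorem moveHom_comp {a c : (logShapePlus (isArc := isArc) v).Vertex} (r : Path a c)
    {g g' g'' : Path c (logShapePlus v).obs}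
    (α : (L.logDiagramPlus v).pathFunctor g ⟶ (L.logDiagramPlus v).pathFunctor g')
    (β : (L.logDiagramPlus v).pathFunctor g' ⟶ (L.logDiagramPlus v).pathFunctor g'')
    {p p' p'' : Path a (logShapePlus v).obs} (hp : p = r.comp g) (hp' : p' = r.comp g') (hp'' : p'' = r.comp g'') :
    (L.logDiagramPlus v).moveHom r α hp hp' ≫ (L.logDiagramPlus v).moveHom r β hp' hp'' =
      (L.logDiagramPlus v).moveHom r (α ≫ β) hp hp'' := by
  subst hp hp' hp''
  simp only [DiagramOfCategories.moveHom, Category.assoc, eqToHom_trans_assoc, eqToHom_refl, Category.id_comp,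
    Functor.whiskerLeft_comp]

/-- **The chain out of `[λ⊞_ν] ∘ r` when `ν` has a unique outgoing edge `ν → ν₃`**: it is empty, or its first move is
the `pre`-move along that edge (unique decomposition + `LogGen` case analysis).
[cite: MochizukiAbsTopIII2015, Cor 5.5 (iii) p. 131] -/
theorem chain_from_lamPath {a : (logShapePlus (isArc := isArc) v).Vertex}
    (r : Path a ((logShapePlus (isArc := isArc) v).base ⟨.core, core_mem_two⟩)) {ν ν₃ : LogVertex (isArc v)}
    (h : ν.isPostLog = false) (h₃ : ν₃.isPostLog = false) (δ : LogEdge (isArc v) ν ν₃)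
    (huniq : ∀ ν₄ : LogVertex (isArc v), LogEdge (isArc v) ν ν₄ → ν₄ = ν₃)
    {q : Path a (logShapePlus v).obs} (c : DiagramOfCategories.Chain (LogGen v) (r.comp (lamPath v ν h)) q) :
    (∃ e : r.comp (lamPath v ν h) = q, c.hom (L.logGenHom v) = eqToHom (by rw [e])) ∨
      ∃ c₂ : DiagramOfCategories.Chain (LogGen v) (r.comp (lamPath v ν₃ h₃)) q,
        c.hom (L.logGenHom v) =
          (L.logDiagramPlus v).moveHom r (L.logGenHom v (LogGen.pre ν ν₃ δ h h₃)) rfl rfl ≫ c₂.hom (L.logGenHom v) := by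
  cases c with
  | nil _ => exact Or.inl ⟨rfl, by simp⟩
  | cons m rest =>
    right
    obtain ⟨c, r', g, g', s, hp, hp'⟩ := m
    cases s with
    | pre ν₁ ν₂ ε h₁ h₂ =>
      obtain ⟨rfl, rfl⟩ := eq_of_comp_lamPath_eq v hp
      obtain rfl : ν₂ = ν₃ := huniq ν₂ ε
      obtain rfl : ε = δ := LogVertex.logEdge_subsingleton _ ε δ
      subst hp'
      exact ⟨rest, by rw [DiagramOfCategories.Chain.hom_cons]; rfl⟩
    | post ν₁ ν₂ ε h₁ h₂ hsl n =>
      obtain ⟨rfl, -⟩ := eq_of_comp_lamPath_eq_comp_postLogDomPath v hp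
      exact ((LogVertex.isEmpty_logEdge_spaceLink _ ν₃).false δ).elim

/-- **The commutativity of the `ι⊞`-squares of `Γ⃗^log_v`** — a CONDITION on the setting `L` at the place `v` (the
Def 5.4 (iii) datum at the level of components, compared through `HEq` as in `iota_comp_eq_of_cor55Observables`;
a PREDICATE on the interface, refutable at some settings — `exists_not_forall_iotaSquaresCommute` — and automatic at
others, NOT a fact and never assumed in this file): for any two 2-chains `ν₁ → ν₂ → ν₃`, `ν₁ → ν₂' → ν₃` of
`ι⊞`-carrying edges between pre-log vertices, the composites of the `ι⊞`-components agree.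
[cite: MochizukiAbsTopIII2015, Def 5.4 (iii) p. 126] -/
def IotaSquaresCommute : Prop :=
  ∀ ⦃ν₁ ν₂ ν₂' ν₃ : LogVertex (isArc v)⦄ (_ : ν₁.isPostLog = false) (_ : ν₂.isPostLog = false)
    (_ : ν₂'.isPostLog = false) (_ : ν₃.isPostLog = false) (ε₁₂ : LogEdge (isArc v) ν₁ ν₂)
    (ε₂₃ : LogEdge (isArc v) ν₂ ν₃) (ε₁₂' : LogEdge (isArc v) ν₁ ν₂') (ε₂'₃ : LogEdge (isArc v) ν₂' ν₃) (X₀ : L.X)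
    (m₁₂ : (L.lam v ν₁).obj X₀ ⟶ (L.lam v ν₂).obj X₀) (m₂₃ : (L.lam v ν₂).obj X₀ ⟶ (L.lam v ν₃).obj X₀)
    (m₁₂' : (L.lam v ν₁).obj X₀ ⟶ (L.lam v ν₂').obj X₀) (m₂'₃ : (L.lam v ν₂').obj X₀ ⟶ (L.lam v ν₃).obj X₀),
    HEq m₁₂ ((L.iota v ε₁₂).app X₀) → HEq m₂₃ ((L.iota v ε₂₃).app X₀) → HEq m₁₂' ((L.iota v ε₁₂').app X₀) →
      HEq m₂'₃ ((L.iota v ε₂'₃).app X₀) → m₁₂ ≫ m₂₃ = m₁₂' ≫ m₂'₃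

/-- **The square of generator homotopies commutes** when the `ι⊞`-squares do: for a fork `ν₁ → ν₂`, `ν₁ → ν₂'`
closing into `ν₃`, the two composites of `pre`-moves with a common prefix `r` agree.
[cite: MochizukiAbsTopIII2015, Cor 5.5 (iii) p. 131] -/
theorem moveHom_square (hsq : L.IotaSquaresCommute v) {a : (logShapePlus (isArc := isArc) v).Vertex}
    (r : Path a ((logShapePlus (isArc := isArc) v).base ⟨.core, core_mem_two⟩)) {ν₁ ν₂ ν₂' ν₃ : LogVertex (isArc v)}
    (h₁ : ν₁.isPostLog = false) (h₂ : ν₂.isPostLog = false) (h₂' : ν₂'.isPostLog = false)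
    (h₃ : ν₃.isPostLog = false) (ε : LogEdge (isArc v) ν₁ ν₂) (δ : LogEdge (isArc v) ν₂ ν₃)
    (ε' : LogEdge (isArc v) ν₁ ν₂') (δ' : LogEdge (isArc v) ν₂' ν₃) :
    (L.logDiagramPlus v).moveHom r (L.logGenHom v (LogGen.pre ν₁ ν₂ ε h₁ h₂)) rfl rfl ≫
        (L.logDiagramPlus v).moveHom r (L.logGenHom v (LogGen.pre ν₂ ν₃ δ h₂ h₃)) rfl rfl =
      (L.logDiagramPlus v).moveHom r (L.logGenHom v (LogGen.pre ν₁ ν₂' ε' h₁ h₂')) rfl rfl ≫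
        (L.logDiagramPlus v).moveHom r (L.logGenHom v (LogGen.pre ν₂' ν₃ δ' h₂' h₃)) rfl rfl := by
  rw [moveHom_comp, moveHom_comp]
  congr 1
  ext X₀
  have t₁ : (L.lam v ν₁).obj X₀ = (frobeniusTwist L.log ν₁.isPostLog ⋙ L.lam v ν₁).obj X₀ := by
    simp [frobeniusTwist, h₁]
  have t₂ : (L.lam v ν₂).obj X₀ = (frobeniusTwist L.log ν₂.isPostLog ⋙ L.lam v ν₂).obj X₀ := by
    simp [frobeniusTwist, h₂]
  have t₂' : (L.lam v ν₂').obj X₀ = (frobeniusTwist L.log ν₂'.isPostLog ⋙ L.lam v ν₂').obj X₀ := by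
    simp [frobeniusTwist, h₂']
  have key := hsq h₁ h₂ h₂' h₃ ε δ ε' δ' X₀
    (eqToHom t₁ ≫ (L.iota v ε).app X₀ ≫ eqToHom (rfl : (L.lam v ν₂).obj X₀ = _).symm)
    (eqToHom t₂ ≫ (L.iota v δ).app X₀ ≫ eqToHom (rfl : (L.lam v ν₃).obj X₀ = _).symm)
    (eqToHom t₁ ≫ (L.iota v ε').app X₀ ≫ eqToHom (rfl : (L.lam v ν₂').obj X₀ = _).symm)
    (eqToHom t₂' ≫ (L.iota v δ').app X₀ ≫ eqToHom (rfl : (L.lam v ν₃).obj X₀ = _).symm)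
    ((conj_eqToHom_iff_heq _ _ t₁ rfl).mp rfl) ((conj_eqToHom_iff_heq _ _ t₂ rfl).mp rfl)
    ((conj_eqToHom_iff_heq _ _ t₁ rfl).mp rfl) ((conj_eqToHom_iff_heq _ _ t₂' rfl).mp rfl)
  simp only [eqToHom_refl, Category.comp_id, Category.assoc] at key
  have mid := (cancel_epi _).mp key
  simp only [logGenHom, NatTrans.comp_app, eqToHom_app, Category.assoc, eqToHom_trans_assoc]
  congr 1
  simp only [← Category.assoc]
  congr 1
  simp only [Category.assoc]
  convert mid using 3 <;> rfl

/-- **COHERENCE of the move system of `S_log⊞`**: if the `ι⊞`-squares of `Γ⃗^log_v` commute, any two chains of moves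
between the same two paths of `D•_{≤2} ∪ {𝒩⊞_v}` have the same homotopy.  (Induction on the weight of the source path:
the first moves of two chains out of a path coincide — unique decomposition — unless they form the nonarchimedean fork
`𝒪^×_k̄ → {k̄^×, k~}`, which closes at once into `(k̄^×)^pf` with equal composites by `moveHom_square`.)
[cite: MochizukiAbsTopIII2015, Cor 5.5 (iii) p. 131] -/
theorem chain_hom_eq_of_iotaSquaresCommute (hsq : L.IotaSquaresCommute v) :
    ∀ (n : ℕ) {a : (logShapePlus (isArc := isArc) v).Vertex} {p q : Path a (logShapePlus v).obs}
      (c c' : DiagramOfCategories.Chain (LogGen v) p q), pathWt v p < n →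
      c.hom (L.logGenHom v) = c'.hom (L.logGenHom v)
  | 0, _, _, _, _, _, h => absurd h (Nat.not_lt_zero _)
  | n + 1, a, p, q, c, c', hlt => by
    have IH : ∀ {p' q' : Path a (logShapePlus v).obs} (d d' : DiagramOfCategories.Chain (LogGen v) p' q'),
        pathWt v p' < pathWt v p → d.hom (L.logGenHom v) = d'.hom (L.logGenHom v) :=
      fun d d' h => chain_hom_eq_of_iotaSquaresCommute hsq n d d' (by omega)
    cases c with
    | nil _ =>
      cases c' with
      | nil _ => rfl
      | cons m' rest' => exact absurd (pathWt_lt_of_cons v m' rest') (lt_irrefl _)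
    | cons m rest =>
      cases c' with
      | nil _ => exact absurd (pathWt_lt_of_cons v m rest) (lt_irrefl _)
      | cons m' rest' =>
        rw [DiagramOfCategories.Chain.hom_cons, DiagramOfCategories.Chain.hom_cons]
        obtain ⟨c₁, r₁, g₁, g₁', s₁, hp₁, hp₁'⟩ := m
        obtain ⟨c₂, r₂, g₂, g₂', s₂, hp₂, hp₂'⟩ := m'
        cases s₁ with
        | pre ν₁ ν₂ ε h₁ h₂ =>
          cases s₂ with
          | pre ν₁' ν₂' ε' h₁' h₂' =>
            obtain ⟨rfl, rfl⟩ := eq_of_comp_lamPath_eq v (hp₁.symm.trans hp₂)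
            subst hp₁ hp₁' hp₂'
            have hw₂ : pathWt v (r₁.comp (lamPath v ν₂ h₂)) < pathWt v (r₁.comp (lamPath v ν₁ h₁)) := by
              rw [pathWt_comp, pathWt_comp, pathWt_lamPath, pathWt_lamPath]
              exact Nat.add_lt_add_left (LogVertex.rank_lt_of_logEdge _ ε h₁) _
            by_cases hν : ν₂ = ν₂'
            · subst hν
              obtain rfl : ε = ε' := LogVertex.logEdge_subsingleton _ ε ε'
              congr 1
              exact IH rest rest' hw₂
            · obtain ⟨ν₃, δ, δ', -, -, h₃, hrk, hu, hu'⟩ := LogVertex.logEdge_fork _ h₁ ε ε' hν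
              have hw₃ : pathWt v (r₁.comp (lamPath v ν₃ h₃)) < pathWt v (r₁.comp (lamPath v ν₁ h₁)) := by
                rw [pathWt_comp, pathWt_comp, pathWt_lamPath, pathWt_lamPath]
                exact Nat.add_lt_add_left
                  ((LogVertex.rank_lt_of_logEdge _ δ h₂).trans (LogVertex.rank_lt_of_logEdge _ ε h₁)) _
              -- both chains continue through `ν₃`
              rcases L.chain_from_lamPath v r₁ h₂ h₃ δ hu rest with ⟨e, -⟩ | ⟨d₂, hd₂⟩
              · -- `rest` empty: then `rest'` would join two distinct paths of equal weight
                exfalso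
                rcases L.chain_from_lamPath v r₁ h₂' h₃ δ' hu' rest' with ⟨e', -⟩ | ⟨d₂', -⟩
                · exact hν (eq_of_comp_lamPath_eq v (e.trans e'.symm)).1
                · have hw := pathWt_le_of_chain v d₂'
                  have hw' := LogVertex.rank_lt_of_logEdge _ δ' h₂'
                  rw [← e, pathWt_comp, pathWt_comp, pathWt_lamPath, pathWt_lamPath, hrk] at hw
                  omega
              rcases L.chain_from_lamPath v r₁ h₂' h₃ δ' hu' rest' with ⟨e', -⟩ | ⟨d₂', hd₂'⟩
              · exfalso
                have hw := pathWt_le_of_chain v d₂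
                have hw' := LogVertex.rank_lt_of_logEdge _ δ h₂
                rw [← e', pathWt_comp, pathWt_comp, pathWt_lamPath, pathWt_lamPath, ← hrk] at hw
                omega
              rw [hd₂, hd₂', ← Category.assoc, ← Category.assoc, IH d₂ d₂' hw₃]
              congr 1
              exact L.moveHom_square v hsq r₁ h₁ h₂ h₂' h₃ ε δ ε' δ'
          | post ν₁' ν₂' ε' h₁' h₂' hsl' n' =>
            obtain ⟨rfl, -⟩ := eq_of_comp_lamPath_eq_comp_postLogDomPath v (hp₁.symm.trans hp₂)
            exact ((LogVertex.isEmpty_logEdge_spaceLink _ ν₂).false ε).elim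
        | post ν₁ ν₂ ε h₁ h₂ hsl k =>
          cases s₂ with
          | pre ν₁' ν₂' ε' h₁' h₂' =>
            obtain ⟨rfl, -⟩ := eq_of_comp_lamPath_eq_comp_postLogDomPath v (hp₂.symm.trans hp₁)
            exact ((LogVertex.isEmpty_logEdge_spaceLink _ ν₂').false ε').elim
          | post ν₁' ν₂' ε' h₁' h₂' hsl' k' =>
            obtain ⟨rfl, hr⟩ := eq_of_comp_postLogDomPath_eq v (hp₁.symm.trans hp₂)
            obtain rfl := eq_of_heq hr
            obtain rfl : ν₁ = ν₁' :=
              (LogVertex.eq_postLog_of_isPostLog _ h₁).trans (LogVertex.eq_postLog_of_isPostLog _ h₁').symm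
            obtain rfl : ν₂ = ν₂' := LogVertex.logEdge_post_target_eq _ h₁ ε ε'
            obtain rfl : ε = ε' := LogVertex.logEdge_subsingleton _ ε ε'
            subst hp₁ hp₁' hp₂'
            have hw₂ : pathWt v (r₁.comp (postLogCodPath v k ν₂ h₂)) < pathWt v (r₁.comp (postLogDomPath v k hsl)) := by
              rw [pathWt_comp, pathWt_comp, pathWt_postLogDomPath, pathWt_postLogCodPath]
              exact Nat.add_lt_add_left (LogVertex.rank_lt_of_logEdge_post _ ε h₁) _
            congr 1
            exact IH rest rest' hw₂

/-! ## The observable `S_log⊞` from commuting `ι⊞`-squares -/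

/-- Coherence in the form consumed by the toolkit: any two chains between the same two paths into `𝒩⊞_v` have the same
homotopy. [cite: MochizukiAbsTopIII2015, Cor 5.5 (iii) p. 131] -/
theorem chain_hom_eq (hsq : L.IotaSquaresCommute v) {a : (logShapePlus (isArc := isArc) v).Vertex}
    (p q : Path a (logShapePlus v).obs) (c c' : DiagramOfCategories.Chain (LogGen v) p q) :
    c.hom (L.logGenHom v) = c'.hom (L.logGenHom v) :=
  L.chain_hom_eq_of_iotaSquaresCommute v hsq (pathWt v p + 1) c c' (Nat.lt_succ_self _)

/-- `𝒩⊞_v` has no outgoing arrow in `D•_{≤2} ∪ {𝒩⊞_v}`. [cite: MochizukiAbsTopIII2015, Cor 5.5 (iii) p. 131] -/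
theorem isEmpty_hom_logObs (b : (logShapePlus (isArc := isArc) v).Vertex) : IsEmpty ((logShapePlus v).obs ⟶ b) :=
  DiagramOfCategories.ExtShape.isEmpty_hom_obs _ (fun _ => (inferInstance : IsEmpty PEmpty.{u + 1})) b

/-- **The family of homotopies of `S_log⊞` at `v`**, CONSTRUCTED from commuting `ι⊞`-squares: the family generated
(toolkit `chainFamily`) by the printed pairs `([λ⊞_{ν₁}], [λ⊞_{ν₂}])`, `([λ⊞_{sl}]∘[id_⋎]∘[log], [λ⊞_{ν₂}]∘[id_{⋎+1}])`
with homotopies `ι⊞_{v,ε}`, whiskered and composed. [cite: MochizukiAbsTopIII2015, Cor 5.5 (iii) p. 131] -/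
noncomputable def logObsFamily (hsq : L.IotaSquaresCommute v) : (L.logDiagramPlus v).HomotopyFamily :=
  DiagramOfCategories.chainFamily (L.logDiagramPlus v) (LogGen v) (L.logGenHom v) (logShapePlus v).obs
    (isEmpty_hom_logObs v) (fun p q c c' => L.chain_hom_eq v hsq p q c c')

/-- Transport of a component of a natural transformation along an equality of objects. [folklore] -/
private theorem app_congr_obj'' {A B : Type*} [Category A] [Category B] {F G : A ⥤ B} (α : F ⟶ G) {y y' : A}
    (hy : y = y') : α.app y = eqToHom (by rw [hy]) ≫ α.app y' ≫ eqToHom (by rw [hy]) := by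
  subst hy
  simp

/-- `eqToHom` bookkeeping: a doubly conjugated morphism is singly conjugated (all `eqToHom`s between the same objects
agree). [folklore] -/
private theorem eqToHom_conj₃ {C : Type*} [Category C] {a₀ a b c d e₁ e₂ e₃ : C} (o : a₀ = a) (p : a = b)
    (q : b = c) (g : c ⟶ d) (r : d = e₁) (s' : e₁ = e₂) (s'' : e₂ = e₃) (t : a₀ = c) (u : d = e₃) :
    eqToHom o ≫ (eqToHom p ≫ (eqToHom q ≫ g ≫ eqToHom r) ≫ eqToHom s') ≫ eqToHom s'' = eqToHom t ≫ g ≫ eqToHom u := by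
  subst o p q r s' s''
  simp

/-- **`S_log⊞` IS an observable as typed** (`IsLogObservablePlus`): all boundary paths end at `𝒩⊞_v`, and the two
printed kinds of pairs are boundary pairs carrying exactly `ι⊞_{v,ε}` (componentwise).
[cite: MochizukiAbsTopIII2015, Cor 5.5 (iii) p. 131] -/
theorem isLogObservablePlus_logObsFamily (hsq : L.IotaSquaresCommute v) :
    L.IsLogObservablePlus v (L.logObsFamily v hsq) := by
  refine ⟨fun _ _ _ _ h => h.1, ?_, ?_⟩
  · intro ν₁ ν₂ ε h₁ h₂
    let s : LogGen v (lamPath v ν₁ h₁) (lamPath v ν₂ h₂) := LogGen.pre ν₁ ν₂ ε h₁ h₂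
    refine ⟨DiagramOfCategories.chainFamily_mem _ _ _ _ _ _
      (DiagramOfCategories.Chain.cons ⟨_, Path.nil, _, _, s, (Path.nil_comp _).symm, (Path.nil_comp _).symm⟩
        (DiagramOfCategories.Chain.nil _)), fun X₀ => ?_⟩
    obtain ⟨h', e, e', hη⟩ := DiagramOfCategories.chainFamily_η_gen (L.logDiagramPlus v) (LogGen v) (L.logGenHom v)
      (logShapePlus v).obs (isEmpty_hom_logObs v) (fun p q c c' => L.chain_hom_eq v hsq p q c c') s X₀
    refine ⟨Functor.congr_obj (L.pathFunctor_lamPath v ν₁ h₁) X₀,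
      Functor.congr_obj (L.pathFunctor_lamPath' v ν₂ h₂) X₀, ?_⟩
    refine hη.trans ?_
    simp only [s, logGenHom, NatTrans.comp_app, eqToHom_app]
    erw [app_congr_obj'' (L.iota v ε) ((L.logDiagramPlus v).pathFunctor_nil_obj
      ((logShapePlus (isArc := isArc) v).base ⟨.core, core_mem_two⟩) X₀)]
    exact eqToHom_conj₃ (g := (L.iota v ε).app X₀) _ _ _ _ _ _ _ _
  · intro ν₁ ν₂ ε h₁ h₂ hsl n
    let s : LogGen v (postLogDomPath v n hsl) (postLogCodPath v n ν₂ h₂) := LogGen.post ν₁ ν₂ ε h₁ h₂ hsl n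
    refine ⟨DiagramOfCategories.chainFamily_mem _ _ _ _ _ _
      (DiagramOfCategories.Chain.cons ⟨_, Path.nil, _, _, s, (Path.nil_comp _).symm, (Path.nil_comp _).symm⟩
        (DiagramOfCategories.Chain.nil _)), fun X₀ => ?_⟩
    obtain ⟨h', e, e', hη⟩ := DiagramOfCategories.chainFamily_η_gen (L.logDiagramPlus v) (LogGen v) (L.logGenHom v)
      (logShapePlus v).obs (isEmpty_hom_logObs v) (fun p q c c' => L.chain_hom_eq v hsq p q c c') s X₀
    refine ⟨Functor.congr_obj (L.pathFunctor_postLogDomPath v ν₁ h₁ n hsl) X₀,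
      Functor.congr_obj (L.pathFunctor_postLogCodPath v n ν₂ h₂) X₀, ?_⟩
    refine hη.trans ?_
    simp only [s, logGenHom, NatTrans.comp_app, eqToHom_app]
    erw [app_congr_obj'' (L.iota v ε) ((L.logDiagramPlus v).pathFunctor_nil_obj
      ((logShapePlus (isArc := isArc) v).base ⟨.row1 (n + 1), row1_mem_two (n + 1)⟩) X₀)]
    exact eqToHom_conj₃ (g := (L.iota v ε).app X₀) _ _ _ _ _ _ _ _

/-! ## F-0142 ⟺ the commutativity of the `ι⊞`-squares -/

/-- **Cor 5.5 (iii), `⊞`-half, CONSTRUCTED** (FACT-LIST F-0142, sufficiency): if at every place the `ι⊞`-squares of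
`Γ⃗^log_v` commute (the Def 5.4 (iii) commutativity, transported to the `ι⊞`), then for every `v ∈ V(F_mod)` the
`ι⊞_{v,ε}` belong to a family of homotopies determining an observable `S_log⊞` on `D•_{≤2}` as typed.
[cite: MochizukiAbsTopIII2015, Cor 5.5 (iii) p. 131] -/
theorem cor55Observables_of_iotaSquaresCommute (hsq : ∀ v, L.IotaSquaresCommute v) : L.Cor55Observables :=
  fun v => ⟨L.logObsFamily v (hsq v), L.isLogObservablePlus_logObsFamily v (hsq v)⟩

/-- Conversely an observable `S_log⊞` at `v` forces the `ι⊞`-squares at `v` to commute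
(`iota_comp_eq_of_isLogObservablePlus`). [cite: MochizukiAbsTopIII2015, Cor 5.5 (iii) p. 131] -/
theorem iotaSquaresCommute_of_isLogObservablePlus (H : (L.logDiagramPlus v).HomotopyFamily)
    (hH : L.IsLogObservablePlus v H) : L.IotaSquaresCommute v :=
  fun _ _ _ _ h₁ h₂ h₂' h₃ ε₁₂ ε₂₃ ε₁₂' ε₂'₃ X₀ m₁₂ m₂₃ m₁₂' m₂'₃ hm₁₂ hm₂₃ hm₁₂' hm₂'₃ =>
    L.iota_comp_eq_of_isLogObservablePlus v H hH h₁ h₂ h₂' h₃ ε₁₂ ε₂₃ ε₁₂' ε₂'₃ X₀ m₁₂ m₂₃ m₁₂' m₂'₃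
      hm₁₂ hm₂₃ hm₁₂' hm₂'₃

/-- **F-0142 located exactly: `Cor55Observables L` holds if and only if the `ι⊞`-squares commute at every place** —
the typed Cor 5.5 (iii) (`⊞`-half) is EQUIVALENT, over the interface `LogFrobeniusSetting`, to the Def 5.4 (iii)
commutativity of the `ι⊞_{v,ε}` (which print has: the diagram of Def 5.4 (iii) is commutative and `ι⊞_{v,ε}` is induced
by the arrow `ε`, Def 5.4 (vii); the interface does not record it).  An observable at `v` exists iff the squares at
`v` commute. [cite: MochizukiAbsTopIII2015, Cor 5.5 (iii) p. 131] -/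
theorem cor55Observables_iff_iotaSquaresCommute : L.Cor55Observables ↔ ∀ v, L.IotaSquaresCommute v :=
  ⟨fun h v => by obtain ⟨H, hH⟩ := h v; exact L.iotaSquaresCommute_of_isLogObservablePlus v H hH,
    L.cor55Observables_of_iotaSquaresCommute⟩

/-- The observable `S_log⊞` at a single place exists iff the `ι⊞`-squares there commute.
[cite: MochizukiAbsTopIII2015, Cor 5.5 (iii) p. 131] -/
theorem exists_isLogObservablePlus_iff :
    (∃ H : (L.logDiagramPlus v).HomotopyFamily, L.IsLogObservablePlus v H) ↔ L.IotaSquaresCommute v :=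
  ⟨fun ⟨H, hH⟩ => L.iotaSquaresCommute_of_isLogObservablePlus v H hH,
    fun hsq => ⟨L.logObsFamily v hsq, L.isLogObservablePlus_logObsFamily v hsq⟩⟩

/-- **At an ARCHIMEDEAN place the squares commute for free** (`Γ⃗^log_arc` is linear: two 2-chains with the same ends
coincide), so the observable `S_log⊞_v` exists for EVERY setting there.
[cite: MochizukiAbsTopIII2015, Def 5.4 (v) p. 127] -/
theorem iotaSquaresCommute_of_isArc (hv : isArc v = true) : L.IotaSquaresCommute v := by
  intro ν₁ ν₂ ν₂' ν₃ h₁ h₂ h₂' h₃ ε₁₂ ε₂₃ ε₁₂' ε₂'₃ X₀ m₁₂ m₂₃ m₁₂' m₂'₃ hm₁₂ hm₂₃ hm₁₂' hm₂'₃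
  obtain rfl : ν₂ = ν₂' := logEdge_chain_unique_of_eq_true (isArc v) hv ε₁₂ ε₂₃ ε₁₂' ε₂'₃
  obtain rfl : ε₁₂ = ε₁₂' := LogVertex.logEdge_subsingleton _ ε₁₂ ε₁₂'
  obtain rfl : ε₂₃ = ε₂'₃ := LogVertex.logEdge_subsingleton _ ε₂₃ ε₂'₃
  obtain rfl : m₁₂ = m₁₂' := eq_of_heq (hm₁₂.trans hm₁₂'.symm)
  obtain rfl : m₂₃ = m₂'₃ := eq_of_heq (hm₂₃.trans hm₂'₃.symm)
  rfl

/-- Hence over an index set ALL of whose places are archimedean, `Cor55Observables L` holds for EVERY setting `L`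
(the typed row F-0142 is a genuine assumption only through the nonarchimedean places).
[cite: MochizukiAbsTopIII2015, Cor 5.5 (iii) p. 131] -/
theorem cor55Observables_of_forall_isArc (h : ∀ v, isArc v = true) : L.Cor55Observables :=
  L.cor55Observables_of_iotaSquaresCommute fun v => L.iotaSquaresCommute_of_isArc v (h v)

/-- The condition is a genuine one: over every index set with a nonarchimedean place some setting violates it (the
modified diagonal setting of `exists_not_cor55Observables`, through the equivalence).
[cite: MochizukiAbsTopIII2015, Def 5.4 (iii) p. 126] -/
theorem exists_not_forall_iotaSquaresCommute (Vmod : Type u) (isArc : Vmod → Bool) (v₀ : Vmod)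
    (hv₀ : isArc v₀ = false) :
    ∃ L : LogFrobeniusSetting Vmod isArc, ¬ ∀ v, L.IotaSquaresCommute v := by
  obtain ⟨L, hL⟩ := exists_not_cor55Observables Vmod isArc v₀ hv₀
  exact ⟨L, fun h => hL (L.cor55Observables_of_iotaSquaresCommute h)⟩

end LogFrobeniusSetting

end Literature.AnabelianGeometry.AbsoluteAnabelian
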